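import Summits.AtomisticToContinuum.HydrodynamicLimit.Theorems.ImplosionDichotomyDenseExcursionConeDefs
import Literature.MathematicalPhysics.KineticTheory.HardSphereEulerPrimitiveForm
import Literature.Analysis.FluidPDE.IsentropicEulerFiniteSpeedOfPropagation

/-!
# A classical torus solution read in a chart solves `AthermalEulerAt 1` (line `kidder-knob-melnikov`,
# stub `stub_memberCore`)

Helper file (`--supports stmt-AtomisticToContinuum-12586`) for the registered stub
`stub_memberCore : HsEulerConeLocality → ProjectiveCovariance → MemberCore` of the crux
`Summit.AtomisticToContinuum.HydrodynamicLimit.Theses.ImplosionDichotomy.DenseExcursion`.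

**Content** (`memberCore_chart_solves`). For a classical ideal (`σ = 0`) solution
`IsHardSphereEulerSolution 0 T' ρ u θ` on `𝕋³` and a base point `x₀ ∈ 𝕋³`, the chart fields
`(s, v) ↦ ρ s (x₀ + proj v)`, `θ s (x₀ + proj v)`, `u s (x₀ + proj v)` on `ℝ × ℝ³` are jointly `C^∞` on the
slab `[0, T') × ℝ³` (`Torus.IsSmoothSpaceTimeOn` composed with the translation of the chart) and satisfy the
curried primitive ideal system `AthermalEulerAt (fun _ => 1)` of `…ConeDefs.lean` at every interior time
`0 < t < T'`: the hard-sphere pressure at `σ = 0` is `hsPressure 0 ρ θ = ρθ·Z(0) = ρθ`, so the three point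
relations `IsHardSphereEulerSolution.timeDeriv_density_eq / density_mul_timeDeriv_velocity_eq /
timeDeriv_temperature_eq` (`HardSphereEulerPrimitiveForm.lean`, law `ζ ≡ 1` on `J = univ`) apply, and the
torus operators are read in the chart: `Torus.timeDerivWithin = deriv` at interior times,
`Torus.fderiv f (x₀ + proj y) = fderiv (f ∘ (x₀ + proj ·)) y` (`torusFDeriv_chart`, the re-centred lift is
the chart field translated by `y`), hence `Torus.partialDeriv`, `Torus.gradient` likewise.
-/

noncomputable section

open Set Filter Topology InnerProductSpace
open scoped ContDiff RealInnerProductSpace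

namespace Summit.AtomisticToContinuum.HydrodynamicLimit.Theorems.KidderKnobMelnikov

open Literature.MathematicalPhysics.KineticTheory (T3 V3 IsHardSphereEulerSolution hsPressure hsCompressibility
  HsEulerCalc.isContDiff_apply_coord)
open Literature.Analysis.FunctionSpaces
open Literature.Analysis.FluidPDE (IsentropicEuler.clm_apply_eq_sum IsentropicEuler.inner_gradient_eq_fderiv)

namespace MemberCoreProof

/-! ## Chart calculus: torus operators at `x₀ + proj y` versus Mathlib operators of the chart field at `y` -/

section Chart

variable {G : Type*} [NormedAddCommGroup G] [NormedSpace ℝ G]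

/-- Fréchet derivative of a translate at `0`. [folklore] -/
theorem fderiv_translate_zero (F : V3 → G) (y : V3) : fderiv ℝ (fun v => F (y + v)) 0 = fderiv ℝ F y := by
  rw [fderiv_comp_add_left, add_zero]

/-- The torus Fréchet derivative at `x₀ + proj y` is the Fréchet derivative of the chart field
`v ↦ f (x₀ + proj v)` at `y` (the re-centred lift is the chart field translated by `y`; no differentiability
needed). [folklore] -/
theorem torusFDeriv_chart (f : T3 → G) (x₀ : T3) (y : V3) :
    Torus.fderiv f (x₀ + Torus.proj y) = fderiv ℝ (fun v => f (x₀ + Torus.proj v)) y := by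
  have h : Torus.liftAt f (x₀ + Torus.proj y) = fun v => (fun w => f (x₀ + Torus.proj w)) (y + v) := by
    funext v
    simp only [Torus.liftAt_apply, Torus.proj_add, add_assoc]
  rw [Torus.fderiv, h]
  exact fderiv_translate_zero (fun w => f (x₀ + Torus.proj w)) y

/-- The torus gradient at `x₀ + proj y` is the gradient of the chart field at `y`. [folklore] -/
theorem torusGradient_chart (f : T3 → ℝ) (x₀ : T3) (y : V3) :
    Torus.gradient f (x₀ + Torus.proj y) = gradient (fun v => f (x₀ + Torus.proj v)) y := by
  change (toDual ℝ V3).symm (Torus.fderiv f (x₀ + Torus.proj y)) = (toDual ℝ V3).symm _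
  rw [torusFDeriv_chart]

/-- Torus partial derivatives of a `C¹` function at `x₀ + proj y` are partial derivatives of the chart field
at `y`. [folklore] -/
theorem torusPartialDeriv_chart {f : T3 → G} (hf : Torus.IsContDiff 1 f) (i : Fin 3) (x₀ : T3) (y : V3) :
    Torus.partialDeriv i f (x₀ + Torus.proj y) =
      fderiv ℝ (fun v => f (x₀ + Torus.proj v)) y (EuclideanSpace.single i 1) := by
  rw [Torus.partialDeriv_eq_fderiv_apply hf, torusFDeriv_chart]

/-- A jointly smooth space–time field on `S × 𝕋³`, read in the chart at `x₀`, is jointly smooth on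
`S × ℝ³`. [folklore] -/
theorem contDiffOn_chart {S : Set ℝ} {f : ℝ → T3 → G} (hf : Torus.IsSmoothSpaceTimeOn S f) (x₀ : T3) :
    ContDiffOn ℝ ∞ (fun p : ℝ × V3 => f p.1 (x₀ + Torus.proj p.2)) (S ×ˢ univ) := by
  obtain ⟨y₀, rfl⟩ := Torus.proj_surjective x₀
  have h : (fun p : ℝ × V3 => f p.1 (Torus.proj y₀ + Torus.proj p.2)) =
      Torus.stLift f ∘ fun p : ℝ × V3 => (p.1, y₀ + p.2) := by
    funext p
    simp only [Function.comp_apply, Torus.stLift_apply, Torus.proj_add]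
  rw [h]
  exact hf.comp (contDiff_fst.prodMk (contDiff_const.add contDiff_snd)).contDiffOn
    fun p hp => mk_mem_prod (mem_prod.1 hp).1 (mem_univ _)

end Chart

/-! ## Coordinates of vector derivatives (local copies) -/

/-- Coordinates commute with `deriv`. [folklore] -/
private theorem coord_deriv {U : ℝ → V3} {t : ℝ} (hU : DifferentiableAt ℝ U t) (j : Fin 3) :
    deriv U t j = deriv (fun s => U s j) t := by
  have h := ((EuclideanSpace.proj j : V3 →L[ℝ] ℝ).hasFDerivAt.comp_hasDerivAt t hU.hasDerivAt).deriv
  simp only [Function.comp_def] at h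
  simpa using h.symm

/-- Coordinates commute with `fderiv`. [folklore] -/
private theorem coord_fderiv {f : V3 → V3} {x : V3} (hf : DifferentiableAt ℝ f x) (v : V3) (j : Fin 3) :
    fderiv ℝ f x v j = fderiv ℝ (fun y => f y j) x v := by
  have h := ((EuclideanSpace.proj j : V3 →L[ℝ] ℝ).hasFDerivAt.comp x hf.hasFDerivAt).fderiv
  rw [show (fun y => f y j) = (EuclideanSpace.proj j : V3 →L[ℝ] ℝ) ∘ f from rfl, h]
  rfl

/-- Coordinates of the gradient are the partial derivatives. [folklore] -/
private theorem coord_gradient (f : V3 → ℝ) (x : V3) (j : Fin 3) :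
    gradient f x j = fderiv ℝ f x (EuclideanSpace.single j 1) := by
  rw [← IsentropicEuler.inner_gradient_eq_fderiv, EuclideanSpace.inner_single_right]
  simp

/-! ## The equations in the chart -/

section Equations

variable {T' : ℝ} {ρ θ : ℝ → T3 → ℝ} {u : ℝ → T3 → V3}

/-- At `σ = 0` the hard-sphere pressure is the ideal-gas law `p = ρθ` (`ζ ≡ 1`). [folklore] -/
theorem hsPressure_zero_law : ∀ s ∈ Ico 0 T', ∀ z : T3,
    hsPressure 0 (ρ s z) (θ s z) = ρ s z * θ s z * (fun _ : ℝ => (1 : ℝ)) (ρ s z) := by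
  intro s _ z
  simp [hsPressure, hsCompressibility]

variable (hE : IsHardSphereEulerSolution 0 T' ρ u θ)
include hE

/-- **A classical ideal torus solution read in a chart solves `AthermalEulerAt 1` at interior times.**
[folklore] -/
theorem athermalEulerAt_chart (x₀ : T3) {t : ℝ} (ht : t ∈ Ioo 0 T') (y : V3) :
    AthermalEulerAt (fun _ => 1) (fun s v => ρ s (x₀ + Torus.proj v)) (fun s v => θ s (x₀ + Torus.proj v))
      (fun s v => u s (x₀ + Torus.proj v)) t y := by
  have ht' : t ∈ Ico 0 T' := Ioo_subset_Ico_self ht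
  have hti : t ∈ interior (Ico 0 T') := by rwa [interior_Ico]
  have hnhd : Ico 0 T' ∈ 𝓝 t := mem_interior_iff_mem_nhds.1 hti
  have hρJ : ∀ s ∈ Ico 0 T', ∀ z, ρ s z ∈ (univ : Set ℝ) := fun _ _ _ => mem_univ _
  have hζ : ContDiffOn ℝ ∞ (fun _ : ℝ => (1 : ℝ)) univ := contDiffOn_const
  -- the primitive equations at `(t, x₀ + proj y)`
  have h1 := hE.timeDeriv_density_eq ht' (x₀ + Torus.proj y)
  have h2 := fun j => hE.density_mul_timeDeriv_velocity_eq isOpen_univ hζ hρJ hsPressure_zero_law ht'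
    (x₀ + Torus.proj y) j
  have h3 := hE.timeDeriv_temperature_eq isOpen_univ hζ hρJ hsPressure_zero_law ht' (x₀ + Torus.proj y)
  -- regularity of the slices
  have hρ1 : Torus.IsContDiff 1 (ρ t) := (hE.smooth_density.isSmooth_slice ht').isContDiff (by simp)
  have hθ1 : Torus.IsContDiff 1 (θ t) := (hE.smooth_temperature.isSmooth_slice ht').isContDiff (by simp)
  have hu1 : Torus.IsContDiff 1 (u t) := (hE.smooth_velocity.isSmooth_slice ht').isContDiff (by simp)
  have huj1 : ∀ j, Torus.IsContDiff 1 (fun z => u t z j) := fun j => HsEulerCalc.isContDiff_apply_coord hu1 j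
  have hUs : DifferentiableAt ℝ (fun v => u t (x₀ + Torus.proj v)) y :=
    (((hE.smooth_velocity.isSmooth_slice ht').liftAt x₀).differentiable (by simp)).differentiableAt
  have hUt : DifferentiableAt ℝ (fun s => u s (x₀ + Torus.proj y)) t :=
    (hE.smooth_velocity.hasDerivWithinAt_slice ht' (x₀ + Torus.proj y)).differentiableWithinAt.differentiableAt
      hnhd
  -- torus operators in the chart
  have cTρ : Torus.timeDerivWithin (Ico 0 T') ρ t (x₀ + Torus.proj y) = deriv (fun s => ρ s (x₀ + Torus.proj y)) t :=
    Torus.timeDerivWithin_of_mem_interior hti _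
  have cTθ : Torus.timeDerivWithin (Ico 0 T') θ t (x₀ + Torus.proj y) = deriv (fun s => θ s (x₀ + Torus.proj y)) t :=
    Torus.timeDerivWithin_of_mem_interior hti _
  have cTu : ∀ j, Torus.timeDerivWithin (Ico 0 T') (fun s z => u s z j) t (x₀ + Torus.proj y) =
      deriv (fun s => u s (x₀ + Torus.proj y)) t j := fun j => by
    rw [Torus.timeDerivWithin_of_mem_interior hti, coord_deriv hUt]
    rfl
  have cXρ : ∀ i, Torus.partialDeriv i (ρ t) (x₀ + Torus.proj y) =
      fderiv ℝ (fun v => ρ t (x₀ + Torus.proj v)) y (EuclideanSpace.single i 1) :=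
    fun i => torusPartialDeriv_chart hρ1 i x₀ y
  have cXθ : ∀ i, Torus.partialDeriv i (θ t) (x₀ + Torus.proj y) =
      fderiv ℝ (fun v => θ t (x₀ + Torus.proj v)) y (EuclideanSpace.single i 1) :=
    fun i => torusPartialDeriv_chart hθ1 i x₀ y
  have cXu : ∀ i j, Torus.partialDeriv i (fun z => u t z j) (x₀ + Torus.proj y) =
      fderiv ℝ (fun v => u t (x₀ + Torus.proj v) j) y (EuclideanSpace.single i 1) :=
    fun i j => torusPartialDeriv_chart (huj1 j) i x₀ y
  simp only [cTρ, cXρ, cXu] at h1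
  simp only [cTu, cXρ, cXθ, cXu, deriv_const', mul_zero, add_zero, mul_one] at h2
  simp only [cTθ, cXθ, cXu, mul_one] at h3
  rw [athermalEulerAt_one_iff]
  dsimp only
  refine ⟨?_, ?_, ?_⟩
  · rw [h1, IsentropicEuler.clm_apply_eq_sum (fderiv ℝ (fun v => ρ t (x₀ + Torus.proj v)) y)]
    simp only [smul_eq_mul, coord_fderiv hUs, Finset.mul_sum, ← Finset.sum_add_distrib, ← Finset.sum_neg_distrib]
    refine Finset.sum_eq_zero fun i _ => ?_
    ring
  · ext j
    simp only [PiLp.add_apply, PiLp.smul_apply, PiLp.zero_apply, smul_eq_mul, coord_gradient, coord_fderiv hUs]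
    rw [IsentropicEuler.clm_apply_eq_sum (fderiv ℝ (fun v => u t (x₀ + Torus.proj v) j) y)]
    simp only [smul_eq_mul]
    linear_combination h2 j
  · rw [h3, IsentropicEuler.clm_apply_eq_sum (fderiv ℝ (fun v => θ t (x₀ + Torus.proj v)) y)]
    simp only [smul_eq_mul, coord_fderiv hUs]
    ring

end Equations

end MemberCoreProof

open MemberCoreProof in
/-- **A classical ideal (`σ = 0`) hard-sphere–Euler solution on `𝕋³`, read in the chart `v ↦ x₀ + proj v`,
is a jointly smooth solution of the curried primitive ideal system on `[0, T') × ℝ³`.** For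
`IsHardSphereEulerSolution 0 T' ρ u θ` and `x₀ ∈ 𝕋³`: the chart fields `ρ s (x₀ + proj v)`,
`θ s (x₀ + proj v)`, `u s (x₀ + proj v)` are `C^∞` on `[0, T') × ℝ³`, and `AthermalEulerAt (fun _ => 1)` holds
at every `0 < t < T'`, `y ∈ ℝ³` (pressure `hsPressure 0 ρ θ = ρθ`; primitive form of the conservative
system by `IsHardSphereEulerSolution.timeDeriv_density_eq` & co.; torus operators read in the chart).
[folklore] -/
theorem memberCore_chart_solves : ∀ (T' : ℝ) (ρ θ : ℝ → T3 → ℝ) (u : ℝ → T3 → V3) (x₀ : T3),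
    IsHardSphereEulerSolution 0 T' ρ u θ →
    (ContDiffOn ℝ ∞ (fun p : ℝ × V3 => ρ p.1 (x₀ + Torus.proj p.2)) (Set.Ico 0 T' ×ˢ Set.univ) ∧
      ContDiffOn ℝ ∞ (fun p : ℝ × V3 => θ p.1 (x₀ + Torus.proj p.2)) (Set.Ico 0 T' ×ˢ Set.univ) ∧
      ContDiffOn ℝ ∞ (fun p : ℝ × V3 => u p.1 (x₀ + Torus.proj p.2)) (Set.Ico 0 T' ×ˢ Set.univ)) ∧
    ∀ t ∈ Set.Ioo 0 T', ∀ y : V3,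
      AthermalEulerAt (fun _ => 1) (fun s v => ρ s (x₀ + Torus.proj v)) (fun s v => θ s (x₀ + Torus.proj v))
        (fun s v => u s (x₀ + Torus.proj v)) t y :=
  fun _ _ _ _ x₀ hE => ⟨⟨contDiffOn_chart hE.smooth_density x₀, contDiffOn_chart hE.smooth_temperature x₀,
    contDiffOn_chart hE.smooth_velocity x₀⟩, fun _ ht y => athermalEulerAt_chart hE x₀ ht y⟩

end Summit.AtomisticToContinuum.HydrodynamicLimit.Theorems.KidderKnobMelnikov

end
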